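import Mathlib
import Summits.Ventures.HodgeRepro.Tier4.Line1.RTFSetting
import Summits.Ventures.HodgeRepro.Tier4.Line1.RtfSpectralStep
import Summits.Ventures.HodgeRepro.Tier4.Line1.InnerCalculus
import Summits.Ventures.HodgeRepro.Tier4.Line1.HeckeFiniteness
import Summits.Ventures.HodgeRepro.Tier4.Line1.HeckeIsolation
import Summits.Ventures.HodgeRepro.Tier4.Line1.IrreducibleSubspace
import Summits.Ventures.HodgeRepro.Tier4.Line1.GeneratedSubspace
import Summits.Ventures.HodgeRepro.Tier4.Line1.BlockSimple

/-!
# Tier4/Line1/BlockConstituents — (C-PROJ), part 1: THE CONSTITUENTS `Vb ∩ τ m` OF AN `e`-FIXED FINITE-DIMENSIONAL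
BLOCK, their finiteness, and THE HEART `⨆ m, Wm m = Vb` (plan-1's cut S14294 / S14303, TAKEN S14310)

Blind re-derivation cell `pub-hodge-repro`, Tier 4 (README §9–§10), seat t4-L1-p3 (prover, LINE L1, gen 3).  Target tree
path `lean/Summits/Ventures/HodgeRepro/Tier4/Line1/BlockConstituents.lean`; part 2 (the projections and the statement
`exists_block_decomposition`) is `Tier4/Line1/BlockDecomposition.lean`.  Paper proof:
proofs/t4/L1/C-PROJ-block-decomposition-t4-L1-p3.md.  Imports t4-L1-p2's `BlockSimple` (`mem_of_forall_inner_eq_zero`)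
and `GeneratedSubspace` (`R_R_eq_R_conv`, `R_add'`, `R_zero'`), t4-L1-p1's `IrreducibleSubspace` (`inner_smul_left'`)
and `HeckeFiniteness` (`inner_finset_sum_left`, `inner_zero_left`), t4-L1-p5's `HeckeIsolation` (`conj_inner`),
t4-L1-p4's `InnerCalculus` (`eq_of_ae_eq_DG`, `eq_zero_of_inner_self_eq_zero`, `inner_R_eq_inner_R_adj`),
`RtfSpectralStep` (`memLp_two_DG`), `RelClosed` (`R_invariant`, `continuous_R_of_invariant`).  0 printed inputs.

CONTENT.  `hB : S.IsAdaptedONB τ φ n`; `Vb` a finite-dimensional ℂ-subspace of `G → ℂ` with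
`ψ ∈ Vb ↔ Invariant ψ ∧ Continuous ψ ∧ R(e) ψ = ψ` (`hVb`); `e` a test function with `e ⋆ e = e` and `cj (refl e) = e`
(`he_sym` — ADDED to the typing of S14294: `R(e)` must be SELF-ADJOINT for the block to be the sum of its constituents;
both instances have it: `cj_refl_eσ`, `cj_refl_indK`).  `Wm m := {ψ ∈ Vb | ψ ∈ τ m ∨ ψ = 0}` (the `∨ ψ = 0` only for an
empty `τ m`); the `Wm m` are pairwise `S.inner`-orthogonal (`inner_Wm_eq_zero`, from `hB.orthSub`); `S.inner` is
definite on `Vb` (`eq_zero_of_inner_self_Vb`); hence **`finite_support_Wm`**: finitely many `Wm m` are non-zero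
(orthogonal non-zero vectors of the finite-dimensional `Vb` are linearly independent, `LinearIndependent.finite`).
**`iSup_Wm_eq : ⨆ m, Wm m = Vb`** (THE HEART): a `z ∈ Vb` orthogonal to every `Wm m` is orthogonal to every
`R(e)(φ j) ∈ Wm (n j)` (`R_e_phi_mem_Wm`), hence — `S.inner z (φ j) = S.inner (R(e) z) (φ j) = S.inner z (R(e)(φ j))` by the
adjoint identity and `e* = e` — to every `φ j`, hence `z =ᵐ 0` on `DG` by `hB.complete` and `z = 0` by `eq_of_ae_eq_DG`;
p2's `mem_of_forall_inner_eq_zero` (with `V` := all continuous invariant functions, `isInvariantSubspace_continuousInvariant`)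
turns this into `Vb ≤ ⨆ m, Wm m`.  Nothing here moves (P).  Nothing here says anything about the status of the Hodge
conjecture for CM abelian varieties, which is NOT proved (HC_CM is NOT proved by anyone in this repository).
-/

set_option autoImplicit false

noncomputable section

namespace Summit.Ventures.HodgeRepro.Tier4.Line1

open MeasureTheory Topology Set DirectSum

namespace RTF.Setting

variable {G : Type} [Group G] [TopologicalSpace G] [IsTopologicalGroup G] [MeasurableSpace G] [BorelSpace G]
  (S : Setting G)

section Prelim

omit [IsTopologicalGroup G] [BorelSpace G] in
/-- `S.inner ψ 0 = 0`. -/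
theorem inner_zero_right' (ψ : G → ℂ) : S.inner ψ (0 : G → ℂ) = 0 := by
  simp [inner]

/-- the continuous invariant functions form an invariant subspace (the ambient `V` of `mem_of_forall_inner_eq_zero`). -/
theorem isInvariantSubspace_continuousInvariant :
    S.IsInvariantSubspace {ψ : G → ℂ | S.Invariant ψ ∧ Continuous ψ} where
  inv := fun _ hψ => hψ.1
  cont := fun _ hψ => hψ.2
  right := fun ψ hψ g => ⟨fun γ x => by simp only; rw [mul_assoc, hψ.1 γ (x * g)],
    hψ.2.comp (continuous_id.mul continuous_const)⟩
  add := fun ψ hψ φ hφ => ⟨fun γ x => by simp only; rw [hψ.1 γ x, hφ.1 γ x], hψ.2.add hφ.2⟩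
  smul := fun ψ hψ c => ⟨fun γ x => by simp only; rw [hψ.1 γ x], continuous_const.mul hψ.2⟩
  conv := fun ψ hψ f hf => ⟨S.R_invariant f hψ.1, S.continuous_R_of_invariant hf hψ.1 hψ.2⟩

/-- `R(f)` of a finite sum of continuous functions (test function `f`). -/
theorem R_finset_sum' {ι : Type} (t : Finset ι) {f : G → ℂ} (hf : IsTest f) (ψ : ι → G → ℂ)
    (hψ : ∀ i ∈ t, Continuous (ψ i)) : S.R f (∑ i ∈ t, ψ i) = ∑ i ∈ t, S.R f (ψ i) := by
  classical
  induction t using Finset.induction_on with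
  | empty => simp [S.R_zero']
  | insert a t ha ih =>
    have h2 : Continuous (∑ x ∈ t, ψ x) := by
      rw [Finset.sum_fn]
      exact continuous_finsetSum t fun i hi => hψ i (Finset.mem_insert_of_mem hi)
    rw [Finset.sum_insert ha, Finset.sum_insert ha, S.R_add' hf (hψ a (Finset.mem_insert_self a t)) h2,
      ih fun i hi => hψ i (Finset.mem_insert_of_mem hi)]

end Prelim

section Decomposition

variable {τ : ℕ → Set (G → ℂ)} {φ : ℕ → G → ℂ} {n : ℕ → ℕ} (hB : S.IsAdaptedONB τ φ n)
  {e : G → ℂ} (Vb : Submodule ℂ (G → ℂ))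
  (hVb : ∀ ψ, ψ ∈ Vb ↔ S.Invariant ψ ∧ Continuous ψ ∧ S.R e ψ = ψ)

omit [IsTopologicalGroup G] [BorelSpace G] in
include hB in
/-- **the `m`-th constituent of the block**: `{ψ ∈ Vb | ψ ∈ τ m ∨ ψ = 0}` as a subspace of `G → ℂ` (the `∨ ψ = 0` only
matters for an empty `τ m`). -/
def Wm (m : ℕ) : Submodule ℂ (G → ℂ) where
  carrier := {ψ | ψ ∈ Vb ∧ (ψ ∈ τ m ∨ ψ = 0)}
  add_mem' := by
    intro a b ha hb
    refine ⟨Vb.add_mem ha.1 hb.1, ?_⟩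
    rcases ha.2 with ha2 | ha2 <;> rcases hb.2 with hb2 | hb2
    · exact Or.inl ((hB.inv m).add _ ha2 _ hb2)
    · rw [hb2, add_zero]
      exact Or.inl ha2
    · rw [ha2, zero_add]
      exact Or.inl hb2
    · rw [ha2, hb2, add_zero]
      exact Or.inr rfl
  zero_mem' := ⟨Vb.zero_mem, Or.inr rfl⟩
  smul_mem' := by
    intro c a ha
    refine ⟨Vb.smul_mem c ha.1, ?_⟩
    rcases ha.2 with ha2 | ha2
    · exact Or.inl ((hB.inv m).smul _ ha2 c)
    · rw [ha2, smul_zero]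
      exact Or.inr rfl

omit [IsTopologicalGroup G] [BorelSpace G] in
include hB in
/-- the constituents lie in the block. -/
theorem Wm_le (m : ℕ) : Wm S hB Vb m ≤ Vb := fun _ h => h.1

omit [IsTopologicalGroup G] [BorelSpace G] in
include hB in
/-- membership in a constituent. -/
theorem mem_Wm {m : ℕ} {ψ : G → ℂ} : ψ ∈ Wm S hB Vb m ↔ ψ ∈ Vb ∧ (ψ ∈ τ m ∨ ψ = 0) := Iff.rfl

omit [IsTopologicalGroup G] [BorelSpace G] in
include hB in
/-- a non-zero constituent contains `0` in `τ m` (so `Wm m ⊆ τ m`). -/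
theorem zero_mem_tau_of_Wm_ne_bot {m : ℕ} (hm : Wm S hB Vb m ≠ ⊥) : (0 : G → ℂ) ∈ τ m := by
  obtain ⟨ψ, hψ, hne⟩ := (Submodule.ne_bot_iff _).mp hm
  rcases hψ.2 with h | h
  · have := (hB.inv m).smul ψ h 0
    have h0 : (fun x => (0 : ℂ) * ψ x) = (0 : G → ℂ) := by
      funext x
      simp
    rwa [h0] at this
  · exact absurd h hne

omit [IsTopologicalGroup G] [BorelSpace G] in
include hVb in
/-- every element of `Vb` is continuous. -/
theorem continuous_of_mem_Vb {ψ : G → ℂ} (hψ : ψ ∈ Vb) : Continuous ψ := ((hVb ψ).mp hψ).2.1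

omit [IsTopologicalGroup G] [BorelSpace G] in
include hVb in
/-- every element of `Vb` is invariant. -/
theorem invariant_of_mem_Vb {ψ : G → ℂ} (hψ : ψ ∈ Vb) : S.Invariant ψ := ((hVb ψ).mp hψ).1

omit [IsTopologicalGroup G] [BorelSpace G] in
include hB in
/-- distinct constituents are `S.inner`-orthogonal. -/
theorem inner_Wm_eq_zero {m m' : ℕ} (hmm : m ≠ m') {ψ ψ' : G → ℂ} (hψ : ψ ∈ Wm S hB Vb m)
    (hψ' : ψ' ∈ Wm S hB Vb m') : S.inner ψ ψ' = 0 := by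
  rcases hψ.2 with h | h
  · rcases hψ'.2 with h' | h'
    · exact hB.orthSub m m' hmm _ h _ h'
    · rw [h', S.inner_zero_right']
  · rw [h, S.inner_zero_left]

variable [Countable S.Gk] [SecondCountableTopology G] [T2Space G] [MeasurableMul G] [SFinite S.μ]
  [FiniteDimensional ℂ Vb] (he : IsTest e) (he_conv : S.conv e e = e) (he_sym : cj (refl e) = e)

omit [SecondCountableTopology G] [T2Space G] [MeasurableMul G] [SFinite S.μ] [FiniteDimensional ℂ Vb] in
include hVb in
/-- `S.inner` is definite on `Vb`. -/
theorem eq_zero_of_inner_self_Vb {ψ : G → ℂ} (hψ : ψ ∈ Vb) (h : S.inner ψ ψ = 0) : ψ = 0 :=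
  S.eq_zero_of_inner_self_eq_zero (S.invariant_of_mem_Vb Vb hVb hψ) (S.continuous_of_mem_Vb Vb hVb hψ) h

omit [IsTopologicalGroup G] [Countable S.Gk] [SecondCountableTopology G] [T2Space G] [MeasurableMul G]
  [SFinite S.μ] [FiniteDimensional ℂ Vb] in
/-- `S.inner` of a finite sum of continuous functions against a continuous function. -/
theorem inner_finset_sum_left'' {ι : Type} (t : Finset ι) (w : ι → G → ℂ) (hw : ∀ i ∈ t, Continuous (w i))
    {z : G → ℂ} (hz : Continuous z) : S.inner (∑ i ∈ t, w i) z = ∑ i ∈ t, S.inner (w i) z := by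
  have h1 : (∑ i ∈ t, w i) = fun x => ∑ i ∈ t, (1 : ℂ) * w i x := by
    funext x
    simp [Finset.sum_apply]
  rw [h1, S.inner_finset_sum_left z hz t (fun _ => (1 : ℂ)) w hw]
  simp

omit [SecondCountableTopology G] [T2Space G] [MeasurableMul G] [SFinite S.μ] in
include hB hVb in
/-- **finitely many constituents meet the block**: `{m | Wm m ≠ ⊥}` is finite (orthogonal non-zero vectors of the
finite-dimensional `Vb` are linearly independent). -/
theorem finite_support_Wm : {m : ℕ | Wm S hB Vb m ≠ ⊥}.Finite := by
  classical
  have hchoice : ∀ m : {m : ℕ // Wm S hB Vb m ≠ ⊥}, ∃ v : G → ℂ, v ∈ Wm S hB Vb m ∧ v ≠ 0 :=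
    fun m => (Submodule.ne_bot_iff _).mp m.2
  choose v hvmem hvne using hchoice
  have hli : LinearIndependent ℂ v := by
    rw [linearIndependent_iff']
    intro t g hsum k hk
    have hpair : S.inner (∑ i ∈ t, g i • v i) (v k) = 0 := by
      rw [hsum, S.inner_zero_left]
    rw [S.inner_finset_sum_left'' t (fun i => g i • v i)
      (fun i _ => (S.continuous_of_mem_Vb Vb hVb (hvmem i).1).const_smul (g i))
      (S.continuous_of_mem_Vb Vb hVb (hvmem k).1)] at hpair
    have hterm : ∀ i ∈ t, S.inner (g i • v i) (v k) = if i = k then g k * S.inner (v k) (v k) else 0 := by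
      intro i _
      have hcoe : g i • v i = fun x => g i * v i x := by
        funext x
        rfl
      by_cases hik : i = k
      · subst hik
        rw [if_pos rfl, hcoe, S.inner_smul_left' (S.continuous_of_mem_Vb Vb hVb (hvmem i).1)
          (S.continuous_of_mem_Vb Vb hVb (hvmem i).1)]
      · rw [if_neg hik, hcoe, S.inner_smul_left' (S.continuous_of_mem_Vb Vb hVb (hvmem i).1)
          (S.continuous_of_mem_Vb Vb hVb (hvmem k).1),
          S.inner_Wm_eq_zero hB Vb (fun h => hik (Subtype.ext h)) (hvmem i) (hvmem k), mul_zero]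
    rw [Finset.sum_congr rfl hterm, Finset.sum_ite_eq' t k, if_pos hk] at hpair
    rcases mul_eq_zero.mp hpair with h | h
    · exact h
    · exact absurd (S.eq_zero_of_inner_self_Vb Vb hVb (hvmem k).1 h) (hvne k)
  -- move the family into the finite-dimensional `Vb`
  have hli' : LinearIndependent ℂ fun m : {m : ℕ // Wm S hB Vb m ≠ ⊥} => (⟨v m, (hvmem m).1⟩ : Vb) :=
    LinearIndependent.of_comp Vb.subtype hli
  exact Set.finite_coe_iff.mp hli'.finite

omit [Countable S.Gk] [FiniteDimensional ℂ Vb] in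
include he he_conv hVb in
/-- `R(e) ψ` lies in the block for every continuous invariant `ψ` (`R(e)(R(e)ψ) = R(e ⋆ e)ψ = R(e)ψ`). -/
theorem R_e_mem_Vb {ψ : G → ℂ} (hψ : S.Invariant ψ) (hψc : Continuous ψ) : S.R e ψ ∈ Vb :=
  (hVb _).mpr ⟨S.R_invariant e hψ, S.continuous_R_of_invariant he hψ hψc, by
    rw [S.R_R_eq_R_conv he he hψc, he_conv]⟩

omit [Countable S.Gk] [FiniteDimensional ℂ Vb] in
include hB he he_conv hVb in
/-- `R(e)(φ j)` lies in the `n j`-th constituent of the block. -/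
theorem R_e_phi_mem_Wm (j : ℕ) : S.R e (φ j) ∈ Wm S hB Vb (n j) :=
  ⟨S.R_e_mem_Vb Vb hVb he he_conv ((hB.inv (n j)).inv _ (hB.mem j)) ((hB.inv (n j)).cont _ (hB.mem j)),
    Or.inl ((hB.inv (n j)).conv _ (hB.mem j) e he)⟩

include hB he he_conv he_sym hVb in
/-- **THE HEART: the constituents span the block** — `⨆ m, Wm m = Vb`.  A `z ∈ Vb` orthogonal to every constituent
is orthogonal to every `R(e)(φ j)`, hence (adjoint identity, `e* = e`) to every `φ j`, hence `z =ᵐ 0` on `DG`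
(`hB.complete`) and `z = 0`; p2's `mem_of_forall_inner_eq_zero` does the rest. -/
theorem iSup_Wm_eq : (⨆ m, Wm S hB Vb m) = Vb := by
  refine le_antisymm (iSup_le fun m => S.Wm_le hB Vb m) ?_
  intro v hv
  refine S.mem_of_forall_inner_eq_zero S.isInvariantSubspace_continuousInvariant Vb ?_ _
    (iSup_le fun m => S.Wm_le hB Vb m) hv ?_
  · intro ψ hψ
    exact ⟨((hVb ψ).mp hψ).1, ((hVb ψ).mp hψ).2.1⟩
  · intro z hz horth
    have hzinv := ((hVb z).mp hz).1
    have hzc := ((hVb z).mp hz).2.1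
    have hzfix := ((hVb z).mp hz).2.2
    have hz0 : z = 0 := by
      have hj : ∀ j, S.inner z (φ j) = 0 := by
        intro j
        have h1 := horth _ (Submodule.mem_iSup_of_mem (n j) (S.R_e_phi_mem_Wm hB Vb hVb he he_conv j))
        calc S.inner z (φ j) = S.inner (S.R e z) (φ j) := by rw [hzfix]
          _ = S.inner z (S.R (cj (refl e)) (φ j)) :=
              S.inner_R_eq_inner_R_adj he hzinv hzc ((hB.inv _).inv _ (hB.mem j)) ((hB.inv _).cont _ (hB.mem j))
          _ = S.inner z (S.R e (φ j)) := by rw [he_sym]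
          _ = starRingEnd ℂ (S.inner (S.R e (φ j)) z) := (S.conj_inner _ _).symm
          _ = 0 := by rw [h1, map_zero]
      have hae := hB.complete z (S.memLp_two_DG hzc) hj
      exact S.eq_of_ae_eq_DG hzinv hzc (fun _ _ => rfl) continuous_const hae
    rw [hz0, S.inner_zero_right']

end Decomposition

end RTF.Setting

end Summit.Ventures.HodgeRepro.Tier4.Line1
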